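import Summits.CriticalPhenomena.CardyFormulaZ2.Theorems.CardyUSTContinuationKirchhoffExtremalLengthG02Interior

/-!
# Local `C¹` structure of subsequential limits of lattice-harmonic functions
# (the derivative part of [GP19] Lemma 4.2, freed from the discretisation)

Support file for `KirchhoffExtremalLength` (route CardyUSTContinuation of `CardyFormulaZ2`, item
stmt-CriticalPhenomena-11234), towards `G02ModulusConvergence` (`…Defs.lean`). The tree's
`SquareTiling.exists_local_hasFDerivAt` and the equi-Lipschitz input of
`SquareTiling.exists_subseq_tendstoLocallyUniformly` are stated for potentials of the
Georgakopoulos–Panagiotis discretisation. Here both are re-derived for an arbitrary sequence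
`H n : ℤ² → [0, 1]` read at meshes `δ' n → 0` under the sole hypothesis that, for every compact
`K ⊆ Ω`, eventually `H n` is lattice harmonic on the interior of every lattice box whose rescaled
closed square lies in `K` (`…G02Interior.lean` supplies the estimates):

* `eventually_lipschitz_of_harmonicOnBoxes`: local equi-Lipschitz bounds (the hypothesis `hL` of
  `exists_subseq_tendstoLocallyUniformly`);
* `exists_local_hasFDerivAt_of_harmonicOnBoxes`: near every point of `Ω` a locally uniform
  subsequential limit `v` is differentiable, its derivative being the locally uniform limit of
  the discrete difference quotients.
-/

noncomputable section

namespace Summit.CriticalPhenomena.CardyFormulaZ2.Theorems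

namespace KirchhoffSlope

open Set Metric Filter Topology
open Literature.Probability.LatticeModels Literature.Probability.LatticeModels.SquareTiling

variable {Ω : Set ℂ}

/-- **Local equi-Lipschitz bounds** for functions `H n : ℤ² → [0, 1]` eventually lattice harmonic
on the boxes of every compact subset of the open set `Ω`, read at meshes `δ' n → 0`
([GP19], §4.1). [cite: GeorgakopoulosPanagiotis2019, §4.1] -/
theorem eventually_lipschitz_of_harmonicOnBoxes (hΩo : IsOpen Ω) {δ' : ℕ → ℝ} (hδ : ∀ n, 0 < δ' n)
    (hδ0 : Tendsto δ' atTop (𝓝 0)) {H : ℕ → Site 2 → ℝ} (h01 : ∀ n x, H n x ∈ Icc (0 : ℝ) 1)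
    (hharm : ∀ K ⊆ Ω, IsCompact K → ∀ᶠ n in atTop, ∀ (a : Site 2) (N : ℕ),
      Complex.Rectangle (meshPoint (δ' n) a) (meshPoint (δ' n) (a + ![(N : ℤ), (N : ℤ)])) ⊆ K →
        IsLatticeHarmonicOn (H n) (boxInterior a N)) :
    ∀ z ∈ Ω, ∃ r > 0, ∃ L ≥ (0 : ℝ), ∀ᶠ n in atTop, ∀ x y : Site 2,
      meshPoint (δ' n) x ∈ ball z r → meshPoint (δ' n) y ∈ ball z r →
        |H n x - H n y| ≤ L * dist (meshPoint (δ' n) x) (meshPoint (δ' n) y) := by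
  intro z hz
  obtain ⟨r₀, hr₀, hzr₀⟩ := Metric.nhds_basis_closedBall.mem_iff.1 (hΩo.mem_nhds hz)
  have hK := topGradConst_pos
  refine ⟨r₀ / 16, by positivity, 64 * topGradConst / r₀, by positivity, ?_⟩
  filter_upwards [(tendsto_order.1 hδ0).2 _ (show (0 : ℝ) < r₀ / 72 by positivity),
    hharm _ hzr₀ (isCompact_closedBall z r₀)] with n hn hh x y hx hy
  exact abs_sub_le_mul_dist_of_harmonicOnBoxes hr₀ (hδ n) hn (h01 n) hh x y hx hy

open Classical in
/-- **Local `C¹`-structure of a subsequential limit** ([GP19], §4.1 via Thm 4.3): under the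
hypotheses of `eventually_lipschitz_of_harmonicOnBoxes`, if the piecewise-constant interpolants
of `H n` converge locally uniformly on `Ω` to `v`, then near every point of `Ω` the limit `v` is
differentiable, with derivative the locally uniform limit of the discrete difference quotients.
[cite: GeorgakopoulosPanagiotis2019, §4.1 (via Thm 4.3)] -/
theorem exists_local_hasFDerivAt_of_harmonicOnBoxes (hΩo : IsOpen Ω) {δ' : ℕ → ℝ} (hδ : ∀ n, 0 < δ' n)
    (hδ0 : Tendsto δ' atTop (𝓝 0)) {H : ℕ → Site 2 → ℝ} (h01 : ∀ n x, H n x ∈ Icc (0 : ℝ) 1)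
    (hharm : ∀ K ⊆ Ω, IsCompact K → ∀ᶠ n in atTop, ∀ (a : Site 2) (N : ℕ),
      Complex.Rectangle (meshPoint (δ' n) a) (meshPoint (δ' n) (a + ![(N : ℤ), (N : ℤ)])) ⊆ K →
        IsLatticeHarmonicOn (H n) (boxInterior a N))
    {v : ℂ → ℝ}
    (hvloc : ∀ z ∈ Ω, ∃ r > 0,
      (∃ L ≥ (0 : ℝ), ∀ w ∈ ball z r, ∀ w' ∈ ball z r, |v w - v w'| ≤ L * dist w w') ∧
      TendstoUniformlyOn (fun n w => H n (nearestSite (δ' n) w)) v atTop (ball z r))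
    {z : ℂ} (hz : z ∈ Ω) :
    ∃ s > 0, ∃ g₀ g₁ : ℂ → ℝ, ContinuousOn g₀ (ball z s) ∧ ContinuousOn g₁ (ball z s) ∧
      TendstoUniformlyOn
        (fun n w => (H n (nearestSite (δ' n) w + Pi.single 0 1) - H n (nearestSite (δ' n) w)) / δ' n)
        g₀ atTop (ball z s) ∧
      TendstoUniformlyOn
        (fun n w => (H n (nearestSite (δ' n) w + Pi.single 1 1) - H n (nearestSite (δ' n) w)) / δ' n)
        g₁ atTop (ball z s) ∧
      ∀ w ∈ ball z s, HasFDerivAt v (g₀ w • Complex.reCLM + g₁ w • Complex.imCLM) w := by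
  obtain ⟨r, hr, ⟨L, hL0, hLip⟩, hconv⟩ := hvloc z hz
  obtain ⟨r₁, hr₁, hzr₁⟩ := Metric.nhds_basis_closedBall.mem_iff.1 (hΩo.mem_nhds hz)
  obtain ⟨r₂, hr₂, hr₂₁, hr₂r⟩ : ∃ r₂ > 0, r₂ ≤ r₁ ∧ r₂ ≤ r := ⟨min r₁ r, lt_min hr₁ hr, min_le_left _ _,
    min_le_right _ _⟩
  have hzr₂ : closedBall z r₂ ⊆ Ω := (closedBall_subset_closedBall hr₂₁).trans hzr₁
  have hbr : ball z (r₂ / 16) ⊆ ball z r := ball_subset_ball (by linarith)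
  have hK := topGradConst_pos
  have hh := hharm _ hzr₂ (isCompact_closedBall z r₂)
  have hconv' : TendstoUniformlyOn (fun n w => H n (nearestSite (δ' n) w)) v atTop (ball z (r₂ / 16)) :=
    hconv.mono hbr
  have hvc : ContinuousOn v (ball z (r₂ / 16)) := by
    refine Metric.continuousOn_iff.2 fun b hb ε hε => ⟨ε / (L + 1), by positivity, fun a ha hab => ?_⟩
    calc dist (v a) (v b) = |v a - v b| := Real.dist_eq _ _
      _ ≤ L * dist a b := hLip a (hbr ha) b (hbr hb)
      _ ≤ L * (ε / (L + 1)) := mul_le_mul_of_nonneg_left hab.le hL0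
      _ < ε := by rw [mul_div_assoc', div_lt_iff₀ (by positivity)]; nlinarith
  have h1 : ∀ᶠ n in atTop, ∀ x : Site 2, meshPoint (δ' n) x ∈ ball z (r₂ / 16) → ∀ k : Fin 4,
      |H n (x + cornerUnit k) - H n x| ≤ (32 * topGradConst / r₂) * δ' n := by
    filter_upwards [(tendsto_order.1 hδ0).2 _ (show (0 : ℝ) < r₂ / 72 by positivity), hh] with n hn hhn x hx k
    calc _ ≤ 32 * topGradConst * δ' n / r₂ :=
          abs_sub_le_of_harmonicOnBoxes hr₂ (hδ n) hn (h01 n) hhn x (ball_subset_ball (by linarith) hx) k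
      _ = 32 * topGradConst / r₂ * δ' n := by ring
  have h2 : ∀ᶠ n in atTop, ∀ x : Site 2, meshPoint (δ' n) x ∈ ball z (r₂ / 16) → ∀ j k : Fin 4,
      |(H n (x + cornerUnit k + cornerUnit j) - H n (x + cornerUnit k)) - (H n (x + cornerUnit j) - H n x)| ≤
        (4096 * topGradConst ^ 2 / r₂ ^ 2) * δ' n ^ 2 := by
    filter_upwards [(tendsto_order.1 hδ0).2 _ (show (0 : ℝ) < r₂ / 288 by positivity), hh] with n hn hhn x hx j k
    calc _ ≤ 4096 * topGradConst ^ 2 * δ' n ^ 2 / r₂ ^ 2 :=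
          abs_second_diff_le_of_harmonicOnBoxes hr₂ (hδ n) hn (h01 n) hhn x hx j k
      _ = 4096 * topGradConst ^ 2 / r₂ ^ 2 * δ' n ^ 2 := by ring
  have hrr : 0 < r₂ / 16 := by positivity
  have hL₁ : (0 : ℝ) ≤ 32 * topGradConst / r₂ := by positivity
  have hL₂ : (0 : ℝ) ≤ 4096 * topGradConst ^ 2 / r₂ ^ 2 := by positivity
  obtain ⟨g₀, hg₀c, hg₀u, hq₀⟩ := exists_partialDeriv_limit hrr hL₁ hL₂ hδ hδ0 hconv' hvc h1 h2 0
  obtain ⟨g₁, hg₁c, hg₁u, hq₁⟩ := exists_partialDeriv_limit hrr hL₁ hL₂ hδ hδ0 hconv' hvc h1 h2 1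
  simp only [Fin.isValue, ↓reduceIte] at hq₀
  simp only [Fin.isValue, one_ne_zero, ↓reduceIte] at hq₁
  have hsub : ball z (r₂ / 16 / 8) ⊆ ball z (r₂ / 16 / 4) := ball_subset_ball (by linarith)
  exact ⟨r₂ / 16 / 8, by positivity, g₀, g₁, hg₀c.mono hsub, hg₁c.mono hsub, hg₀u.mono hsub,
    hg₁u.mono hsub, fun w hw => hasFDerivAt_of_quotient_bounds hrr hL₂ hg₀c hg₁c hq₀ hq₁ hw⟩

end KirchhoffSlope

end Summit.CriticalPhenomena.CardyFormulaZ2.Theorems
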